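import Summits.QuantumFields.YangMills.Theorems.IR.SCFloorTorusMayer
import Summits.QuantumFields.YangMills.Theorems.IR.SCFloorCubeGeometry

/-!
# Strong-coupling floor engine, part 6: the lateral Mayer term and its leading coefficient

Pooled prover `ym-ir-line-bsf-p1` (crux `IR`, stmt-QuantumFields-19354; director-ym R366 pooled queue), support file for
`FacingPlaquetteCovFloor`.  On the doubled torus link configuration, with `φ = Re tr ρ − m₀` (`m₀` the Haar mean, so
`∫ φ = 0`) and the plaquette cost written as `N − Re tr ρ(h) = κ₀ − φ(h)`, `κ₀ = N − m₀`:

* §1 `integral_peel_inl/inr` — **single-bond peeling**: if one copy of a bond of the plaquette `q` is read only through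
  a factor `F(hol_q)`, that factor integrates out to its Haar mean;
* §2 `lateral_leading_coeff` — the leading coefficient of the lateral Mayer term:
  `∫ Δφ(hol_{P₀}) Δφ(hol_{P₁}) ∏ₖ (φ(hol_{ℓₖ} U) + φ(hol_{ℓₖ} U')) dπ = 2 · φ^{*6}(1)` — of the sixteen terms of the
  product only «all in copy `U`» and «all in copy `U'`» survive peeling, and each is the cube integral of part 2.

Group-blind strong-coupling combinatorics on a finite torus; nothing here bears on the Yang–Mills mass gap.
-/

set_option autoImplicit false

noncomputable section

open MeasureTheory Filter Topology Function Finset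
open Literature.MathematicalPhysics.QuantumFieldTheory
open Literature.MathematicalPhysics.QuantumLattice (haarConv)

namespace Summit.QuantumFields.YangMills.Cruxes.IR.SCFloor

open BetaSlopeFloor (dTerm measurable_dTerm exists_bound_plaquetteCost measurable_inl_copy measurable_inr_copy)

variable {L : ℕ} [NeZero L] [Fact (1 < L)] {G : Type*} [Group G] [TopologicalSpace G] [IsTopologicalGroup G]
  [CompactSpace G] [MeasurableSpace G] [BorelSpace G] [SecondCountableTopology G]

/-! ## §1 Single-bond peeling on the doubled configuration -/

/-- **Peeling one bond (left copy).**  If the left copy of a bond `e` of the plaquette `(x; i, j)` is read only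
through the factor `F(hol_{x,ij}(U))`, then `∫ F(hol U) · R dπ = (∫ F dHaar) · ∫ R dπ`. -/
theorem integral_peel_inl (x : Site 4 L) {i j : Fin 4} (hij : i ≠ j) {e : Edge 4 L}
    (he : e ∈ ({(x, i), (x.shift i, j), (x.shift j, i), (x, j)} : Finset (Edge 4 L))) {F : G → ℝ}
    (hF : Continuous F) {R : (Edge 4 L ⊕ Edge 4 L → G) → ℝ} (hRm : Measurable R) {C : ℝ} (hRb : ∀ W, |R W| ≤ C)
    (hR : ∀ W g, R (update W (Sum.inl e) g) = R W) :
    ∫ W, F (plaquetteHolonomy (fun a => W (Sum.inl a)) x i j) * R W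
        ∂(Measure.pi fun _ : Edge 4 L ⊕ Edge 4 L => haarProbability G) =
      (∫ g, F g ∂haarProbability G) * ∫ W, R W ∂(Measure.pi fun _ : Edge 4 L ⊕ Edge 4 L => haarProbability G) := by
  obtain ⟨CF, hCF⟩ := isCompact_univ.exists_bound_of_continuousOn hF.continuousOn
  have hCF' : ∀ g, |F g| ≤ CF := fun g => Real.norm_eq_abs _ ▸ hCF g (Set.mem_univ g)
  have hm : Measurable fun W : Edge 4 L ⊕ Edge 4 L → G =>
      F (plaquetteHolonomy (fun a => W (Sum.inl a)) x i j) * R W :=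
    (hF.measurable.comp ((measurable_plaquetteHolonomy x i j).comp measurable_inl_copy)).mul hRm
  have hb : ∀ W : Edge 4 L ⊕ Edge 4 L → G, |F (plaquetteHolonomy (fun a => W (Sum.inl a)) x i j) * R W| ≤ CF * C :=
    fun W => by
      rw [abs_mul]
      exact mul_le_mul (hCF' _) (hRb W) (abs_nonneg _) ((abs_nonneg _).trans (hCF' 1))
  rw [integral_pi_eq_integral_integral_update (Sum.inl e) hm hb]
  have hinner : ∀ W : Edge 4 L ⊕ Edge 4 L → G,
      (∫ g, (fun W : Edge 4 L ⊕ Edge 4 L → G => F (plaquetteHolonomy (fun a => W (Sum.inl a)) x i j) * R W)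
          (update W (Sum.inl e) g) ∂haarProbability G) = (∫ g, F g ∂haarProbability G) * R W := by
    intro W
    simp only [comp_inl_update_inl, hR]
    rw [integral_mul_const, integral_update_plaquetteHolonomy F x hij _ he]
  simp_rw [hinner]
  exact integral_const_mul _ _

/-- **Peeling one bond (right copy).** -/
theorem integral_peel_inr (x : Site 4 L) {i j : Fin 4} (hij : i ≠ j) {e : Edge 4 L}
    (he : e ∈ ({(x, i), (x.shift i, j), (x.shift j, i), (x, j)} : Finset (Edge 4 L))) {F : G → ℝ}
    (hF : Continuous F) {R : (Edge 4 L ⊕ Edge 4 L → G) → ℝ} (hRm : Measurable R) {C : ℝ} (hRb : ∀ W, |R W| ≤ C)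
    (hR : ∀ W g, R (update W (Sum.inr e) g) = R W) :
    ∫ W, F (plaquetteHolonomy (fun a => W (Sum.inr a)) x i j) * R W
        ∂(Measure.pi fun _ : Edge 4 L ⊕ Edge 4 L => haarProbability G) =
      (∫ g, F g ∂haarProbability G) * ∫ W, R W ∂(Measure.pi fun _ : Edge 4 L ⊕ Edge 4 L => haarProbability G) := by
  obtain ⟨CF, hCF⟩ := isCompact_univ.exists_bound_of_continuousOn hF.continuousOn
  have hCF' : ∀ g, |F g| ≤ CF := fun g => Real.norm_eq_abs _ ▸ hCF g (Set.mem_univ g)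
  have hm : Measurable fun W : Edge 4 L ⊕ Edge 4 L → G =>
      F (plaquetteHolonomy (fun a => W (Sum.inr a)) x i j) * R W :=
    (hF.measurable.comp ((measurable_plaquetteHolonomy x i j).comp measurable_inr_copy)).mul hRm
  have hb : ∀ W : Edge 4 L ⊕ Edge 4 L → G, |F (plaquetteHolonomy (fun a => W (Sum.inr a)) x i j) * R W| ≤ CF * C :=
    fun W => by
      rw [abs_mul]
      exact mul_le_mul (hCF' _) (hRb W) (abs_nonneg _) ((abs_nonneg _).trans (hCF' 1))
  rw [integral_pi_eq_integral_integral_update (Sum.inr e) hm hb]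
  have hinner : ∀ W : Edge 4 L ⊕ Edge 4 L → G,
      (∫ g, (fun W : Edge 4 L ⊕ Edge 4 L → G => F (plaquetteHolonomy (fun a => W (Sum.inr a)) x i j) * R W)
          (update W (Sum.inr e) g) ∂haarProbability G) = (∫ g, F g ∂haarProbability G) * R W := by
    intro W
    simp only [comp_inr_update_inr, hR]
    rw [integral_mul_const, integral_update_plaquetteHolonomy F x hij _ he]
  simp_rw [hinner]
  exact integral_const_mul _ _

/-! ## §2 The leading coefficient of the lateral term -/

variable [T2Space G]

/-- **The leading coefficient of the lateral Mayer term.**  With `φ` a continuous real class function, `φ(g⁻¹) = φ(g)`,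
`∫ φ = 0`, and the four lateral plaquettes `ℓ₀ … ℓ₃ = (0;0,1), (e₂;0,1), (0;0,2), (e₁;0,2)`:
`∫ Δφ(hol_{P₀}) Δφ(hol_{P₁}) ∏ₖ (φ(hol_{ℓₖ} U) + φ(hol_{ℓₖ} U')) dπ = 2 · φ^{*6}(1)` — of the sixteen terms of the
product only «all in copy `U`» and «all in copy `U'`» survive peeling, and each is the cube integral (part 2). -/
theorem lateral_leading_coeff (hL : 3 ≤ L) {φ : G → ℝ} (hφc : Continuous φ)
    (hφz : ∀ g h, φ (h * g * h⁻¹) = φ g) (hφs : ∀ g, φ g⁻¹ = φ g) (hφ0 : ∫ g, φ g ∂haarProbability G = 0) :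
    ∫ W, (φ (plaquetteHolonomy (fun a => W (Sum.inl a)) 0 1 2) - φ (plaquetteHolonomy (fun a => W (Sum.inr a)) 0 1 2)) *
        (φ (plaquetteHolonomy (fun a => W (Sum.inl a)) ((0 : Site 4 L).shift 0) 1 2) -
          φ (plaquetteHolonomy (fun a => W (Sum.inr a)) ((0 : Site 4 L).shift 0) 1 2)) *
        ∏ k : Fin 4, (φ (plaquetteHolonomy (fun a => W (Sum.inl a)) ((![((0 : Site 4 L), ⟨((0 : Fin 4), (1 : Fin 4)), by decide⟩), ((0 : Site 4 L).shift 2, ⟨((0 : Fin 4), (1 : Fin 4)), by decide⟩),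
        ((0 : Site 4 L), ⟨((0 : Fin 4), (2 : Fin 4)), by decide⟩), ((0 : Site 4 L).shift 1, ⟨((0 : Fin 4), (2 : Fin 4)), by decide⟩)] :
        Fin 4 → Plaquette 4 L) k).1 ((![((0 : Site 4 L), ⟨((0 : Fin 4), (1 : Fin 4)), by decide⟩), ((0 : Site 4 L).shift 2, ⟨((0 : Fin 4), (1 : Fin 4)), by decide⟩),
        ((0 : Site 4 L), ⟨((0 : Fin 4), (2 : Fin 4)), by decide⟩), ((0 : Site 4 L).shift 1, ⟨((0 : Fin 4), (2 : Fin 4)), by decide⟩)] :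
        Fin 4 → Plaquette 4 L) k).2.1.1 ((![((0 : Site 4 L), ⟨((0 : Fin 4), (1 : Fin 4)), by decide⟩), ((0 : Site 4 L).shift 2, ⟨((0 : Fin 4), (1 : Fin 4)), by decide⟩),
        ((0 : Site 4 L), ⟨((0 : Fin 4), (2 : Fin 4)), by decide⟩), ((0 : Site 4 L).shift 1, ⟨((0 : Fin 4), (2 : Fin 4)), by decide⟩)] :
        Fin 4 → Plaquette 4 L) k).2.1.2) +
          φ (plaquetteHolonomy (fun a => W (Sum.inr a)) ((![((0 : Site 4 L), ⟨((0 : Fin 4), (1 : Fin 4)), by decide⟩), ((0 : Site 4 L).shift 2, ⟨((0 : Fin 4), (1 : Fin 4)), by decide⟩),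
        ((0 : Site 4 L), ⟨((0 : Fin 4), (2 : Fin 4)), by decide⟩), ((0 : Site 4 L).shift 1, ⟨((0 : Fin 4), (2 : Fin 4)), by decide⟩)] :
        Fin 4 → Plaquette 4 L) k).1 ((![((0 : Site 4 L), ⟨((0 : Fin 4), (1 : Fin 4)), by decide⟩), ((0 : Site 4 L).shift 2, ⟨((0 : Fin 4), (1 : Fin 4)), by decide⟩),
        ((0 : Site 4 L), ⟨((0 : Fin 4), (2 : Fin 4)), by decide⟩), ((0 : Site 4 L).shift 1, ⟨((0 : Fin 4), (2 : Fin 4)), by decide⟩)] :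
        Fin 4 → Plaquette 4 L) k).2.1.1 ((![((0 : Site 4 L), ⟨((0 : Fin 4), (1 : Fin 4)), by decide⟩), ((0 : Site 4 L).shift 2, ⟨((0 : Fin 4), (1 : Fin 4)), by decide⟩),
        ((0 : Site 4 L), ⟨((0 : Fin 4), (2 : Fin 4)), by decide⟩), ((0 : Site 4 L).shift 1, ⟨((0 : Fin 4), (2 : Fin 4)), by decide⟩)] :
        Fin 4 → Plaquette 4 L) k).2.1.2))
      ∂(Measure.pi fun _ : Edge 4 L ⊕ Edge 4 L => haarProbability G) = 2 * ((haarConv φ)^[5] φ) 1 := by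
  classical
  set μ₂ : Measure (Edge 4 L ⊕ Edge 4 L → G) := Measure.pi fun _ => haarProbability G with hμ₂
  set lat : Fin 4 → Plaquette 4 L := (![((0 : Site 4 L), ⟨((0 : Fin 4), (1 : Fin 4)), by decide⟩), ((0 : Site 4 L).shift 2, ⟨((0 : Fin 4), (1 : Fin 4)), by decide⟩),
        ((0 : Site 4 L), ⟨((0 : Fin 4), (2 : Fin 4)), by decide⟩), ((0 : Site 4 L).shift 1, ⟨((0 : Fin 4), (2 : Fin 4)), by decide⟩)] :
        Fin 4 → Plaquette 4 L) with hlat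
  -- abbreviations for the face functions
  set X : (Edge 4 L ⊕ Edge 4 L → G) → ℝ := fun W => φ (plaquetteHolonomy (fun a => W (Sum.inl a)) 0 1 2) with hX
  set X' : (Edge 4 L ⊕ Edge 4 L → G) → ℝ := fun W => φ (plaquetteHolonomy (fun a => W (Sum.inr a)) 0 1 2) with hX'
  set Y : (Edge 4 L ⊕ Edge 4 L → G) → ℝ := fun W =>
    φ (plaquetteHolonomy (fun a => W (Sum.inl a)) ((0 : Site 4 L).shift 0) 1 2) with hY
  set Y' : (Edge 4 L ⊕ Edge 4 L → G) → ℝ := fun W =>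
    φ (plaquetteHolonomy (fun a => W (Sum.inr a)) ((0 : Site 4 L).shift 0) 1 2) with hY'
  set t : Fin 4 → (Edge 4 L ⊕ Edge 4 L → G) → ℝ := fun k W =>
    φ (plaquetteHolonomy (fun a => W (Sum.inl a)) (lat k).1 (lat k).2.1.1 (lat k).2.1.2) with ht
  set t' : Fin 4 → (Edge 4 L ⊕ Edge 4 L → G) → ℝ := fun k W =>
    φ (plaquetteHolonomy (fun a => W (Sum.inr a)) (lat k).1 (lat k).2.1.1 (lat k).2.1.2) with ht'
  -- basic bounds and measurability
  have hφm : Measurable φ := hφc.measurable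
  obtain ⟨Cφ, hCφ⟩ := isCompact_univ.exists_bound_of_continuousOn hφc.continuousOn
  have hCφ' : ∀ g, |φ g| ≤ Cφ := fun g => Real.norm_eq_abs _ ▸ hCφ g (Set.mem_univ g)
  have hC0 : 0 ≤ Cφ := (abs_nonneg _).trans (hCφ' 1)
  set M : ℝ := max Cφ 1 with hM
  have hM1 : 1 ≤ M := le_max_right _ _
  have hCM : Cφ ≤ M := le_max_left _ _
  have hholl : ∀ (x : Site 4 L) (i j : Fin 4), Measurable fun W : Edge 4 L ⊕ Edge 4 L → G =>
      φ (plaquetteHolonomy (fun a => W (Sum.inl a)) x i j) :=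
    fun x i j => hφm.comp ((measurable_plaquetteHolonomy x i j).comp measurable_inl_copy)
  have hholr : ∀ (x : Site 4 L) (i j : Fin 4), Measurable fun W : Edge 4 L ⊕ Edge 4 L → G =>
      φ (plaquetteHolonomy (fun a => W (Sum.inr a)) x i j) :=
    fun x i j => hφm.comp ((measurable_plaquetteHolonomy x i j).comp measurable_inr_copy)
  have hXm : Measurable X := hholl 0 1 2
  have hX'm : Measurable X' := hholr 0 1 2
  have hYm : Measurable Y := hholl _ 1 2
  have hY'm : Measurable Y' := hholr _ 1 2
  have htm : ∀ k, Measurable (t k) := fun k => hholl _ _ _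
  have ht'm : ∀ k, Measurable (t' k) := fun k => hholr _ _ _
  have hXb : ∀ W, |X W| ≤ M := fun W => (hCφ' _).trans hCM
  have hX'b : ∀ W, |X' W| ≤ M := fun W => (hCφ' _).trans hCM
  have hYb : ∀ W, |Y W| ≤ M := fun W => (hCφ' _).trans hCM
  have hY'b : ∀ W, |Y' W| ≤ M := fun W => (hCφ' _).trans hCM
  have htb : ∀ k W, |t k W| ≤ M := fun k W => (hCφ' _).trans hCM
  have ht'b : ∀ k W, |t' k W| ≤ M := fun k W => (hCφ' _).trans hCM
  -- the sixteen partial products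
  set P : Finset (Fin 4) → (Edge 4 L ⊕ Edge 4 L → G) → ℝ := fun A W =>
    (∏ k ∈ A, t k W) * ∏ k ∈ Finset.univ \ A, t' k W with hP
  have hPm : ∀ A, Measurable (P A) := fun A =>
    (Finset.measurable_prod _ fun k _ => htm k).mul (Finset.measurable_prod _ fun k _ => ht'm k)
  have hPb : ∀ A W, |P A W| ≤ M ^ 4 * M ^ 4 := by
    intro A W
    simp only [hP, abs_mul, Finset.abs_prod]
    refine mul_le_mul ?_ ?_ (Finset.prod_nonneg fun _ _ => abs_nonneg _) (by positivity)
    · calc ∏ k ∈ A, |t k W| ≤ ∏ _k ∈ A, M := Finset.prod_le_prod (fun _ _ => abs_nonneg _) fun k _ => htb k W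
        _ = M ^ A.card := Finset.prod_const _
        _ ≤ M ^ 4 := pow_le_pow_right₀ hM1 (by simpa using Finset.card_le_univ A)
    · calc ∏ k ∈ Finset.univ \ A, |t' k W| ≤ ∏ _k ∈ Finset.univ \ A, M :=
            Finset.prod_le_prod (fun _ _ => abs_nonneg _) fun k _ => ht'b k W
        _ = M ^ (Finset.univ \ A).card := Finset.prod_const _
        _ ≤ M ^ 4 := pow_le_pow_right₀ hM1 (by simpa using Finset.card_le_univ (Finset.univ \ A))
  -- integrability of bounded measurable functions
  have hI : ∀ {F : (Edge 4 L ⊕ Edge 4 L → G) → ℝ} {C : ℝ}, Measurable F → (∀ W, |F W| ≤ C) → Integrable F μ₂ :=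
    fun hF hb => Integrable.of_bound hF.aestronglyMeasurable _ (Eventually.of_forall fun W => by
      rw [Real.norm_eq_abs]; exact hb W)
  -- a triple product `a * b * P` is bounded and measurable
  have h3m : ∀ {a b : (Edge 4 L ⊕ Edge 4 L → G) → ℝ} (A : Finset (Fin 4)), Measurable a → Measurable b →
      Measurable fun W => a W * (b W * P A W) := fun A ha hb => ha.mul (hb.mul (hPm A))
  have h3b : ∀ {a b : (Edge 4 L ⊕ Edge 4 L → G) → ℝ} (A : Finset (Fin 4)), (∀ W, |a W| ≤ M) → (∀ W, |b W| ≤ M) →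
      ∀ W, |a W * (b W * P A W)| ≤ M * (M * (M ^ 4 * M ^ 4)) := by
    intro a b A ha hb W
    rw [abs_mul, abs_mul]
    exact mul_le_mul (ha W) (mul_le_mul (hb W) (hPb A W) (abs_nonneg _) (by positivity)) (by positivity)
      (by positivity)
  have h2b : ∀ {b : (Edge 4 L ⊕ Edge 4 L → G) → ℝ} (A : Finset (Fin 4)), (∀ W, |b W| ≤ M) →
      ∀ W, |b W * P A W| ≤ M * (M ^ 4 * M ^ 4) := by
    intro b A hb W
    rw [abs_mul]
    exact mul_le_mul (hb W) (hPb A W) (abs_nonneg _) (by positivity)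
  ------------------------------------------------------------------ geometry of the laterals
  set bottom : Fin 4 → Edge 4 L :=
    ![((0 : Site 4 L), (1 : Fin 4)), ((0 : Site 4 L).shift 2, (1 : Fin 4)), ((0 : Site 4 L), (2 : Fin 4)),
      ((0 : Site 4 L).shift 1, (2 : Fin 4))] with hbottom
  have h1 : (1 : ZMod L) ≠ 0 := one_ne_zero
  have hs0 : ∀ k : Fin 4, (0 : Site 4 L).shift k ≠ 0 := fun k h => by
    have := congrFun h k; simp [shift_apply, h1] at this
  have hs0' : ∀ k : Fin 4, (0 : Site 4 L) ≠ (0 : Site 4 L).shift k := fun k h => hs0 k h.symm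
  have hss : ∀ a b : Fin 4, a ≠ b → (0 : Site 4 L).shift a ≠ (0 : Site 4 L).shift b := fun a b hab h => by
    have := congrFun h a; simp [shift_apply, hab, h1] at this
  have hss2 : ∀ a b c : Fin 4, c ≠ a → c ≠ b → ((0 : Site 4 L).shift a).shift b ≠ (0 : Site 4 L).shift c :=
    fun a b c hca hcb h => by have := congrFun h c; simp [shift_apply, hca, hcb] at this
  have hss2' : ∀ a b c : Fin 4, c ≠ a → c ≠ b → (0 : Site 4 L).shift c ≠ ((0 : Site 4 L).shift a).shift b :=
    fun a b c hca hcb h => hss2 a b c hca hcb h.symm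
  have hss20 : ∀ a b : Fin 4, ((0 : Site 4 L).shift a).shift b ≠ 0 := fun a b h => by
    have := congrFun h a; by_cases hab : a = b
    · subst hab; simp [shift_apply] at this
      exact Literature.MathematicalPhysics.QuantumLattice.zmod_one_add_one_ne_zero_of_three_le hL this
    · simp [shift_apply, hab, h1] at this
  have hss20' : ∀ a b : Fin 4, (0 : Site 4 L) ≠ ((0 : Site 4 L).shift a).shift b := fun a b h => hss20 a b h.symm
  have hssb : ∀ a c : Fin 4, (0 : Site 4 L).shift c ≠ ((0 : Site 4 L).shift a).shift c := fun a c h => by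
    have := congrFun h a
    by_cases hca : c = a
    · subst hca; simp [shift_apply, h1] at this
    · simp [shift_apply, Ne.symm hca] at this
  have hbP0 : ∀ k, bottom k ∈ ({((0 : Site 4 L), (1 : Fin 4)), ((0 : Site 4 L).shift 1, (2 : Fin 4)),
      ((0 : Site 4 L).shift 2, (1 : Fin 4)), ((0 : Site 4 L), (2 : Fin 4))} : Finset (Edge 4 L)) := by
    intro k; fin_cases k <;> simp [hbottom]
  have hbP1 : ∀ k, bottom k ∉ ({(((0 : Site 4 L).shift 0), (1 : Fin 4)), (((0 : Site 4 L).shift 0).shift 1, (2 : Fin 4)),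
      (((0 : Site 4 L).shift 0).shift 2, (1 : Fin 4)), (((0 : Site 4 L).shift 0), (2 : Fin 4))} : Finset (Edge 4 L)) := by
    intro k; fin_cases k <;> simp [hbottom, hs0', hss2', hss, hss20', hssb]
  have hblat : ∀ k k' : Fin 4, k ≠ k' → bottom k ∉ ({((lat k').1, (lat k').2.1.1),
      ((lat k').1.shift (lat k').2.1.1, (lat k').2.1.2), ((lat k').1.shift (lat k').2.1.2, (lat k').2.1.1),
      ((lat k').1, (lat k').2.1.2)} : Finset (Edge 4 L)) := by
    intro k k' hkk'
    fin_cases k <;> fin_cases k' <;> first | exact absurd rfl hkk' | simp [hbottom, hlat, hs0, hs0', hss, hss2', hss20']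
  ------------------------------------------------------------------ behaviour under single-bond updates
  have hX_r : ∀ W e g, X (update W (Sum.inr e) g) = X W := fun W e g => by
    simp only [hX, comp_inl_update_inr]
  have hX'_l : ∀ W e g, X' (update W (Sum.inl e) g) = X' W := fun W e g => by
    simp only [hX', comp_inr_update_inl]
  have hY_r : ∀ W e g, Y (update W (Sum.inr e) g) = Y W := fun W e g => by
    simp only [hY, comp_inl_update_inr]
  have hY'_l : ∀ W e g, Y' (update W (Sum.inl e) g) = Y' W := fun W e g => by
    simp only [hY', comp_inr_update_inl]
  have hY_l : ∀ W k g, Y (update W (Sum.inl (bottom k)) g) = Y W := fun W k g => by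
    simp only [hY, comp_inl_update_inl, plaquetteHolonomy_update_of_not_mem (hbP1 k)]
  have hY'_r : ∀ W k g, Y' (update W (Sum.inr (bottom k)) g) = Y' W := fun W k g => by
    simp only [hY', comp_inr_update_inr, plaquetteHolonomy_update_of_not_mem (hbP1 k)]
  have ht_r : ∀ k W e g, t k (update W (Sum.inr e) g) = t k W := fun k W e g => by
    simp only [ht, comp_inl_update_inr]
  have ht'_l : ∀ k W e g, t' k (update W (Sum.inl e) g) = t' k W := fun k W e g => by
    simp only [ht', comp_inr_update_inl]
  have ht_l : ∀ k k' W g, k ≠ k' → t k' (update W (Sum.inl (bottom k)) g) = t k' W := fun k k' W g hkk' => by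
    simp only [ht, comp_inl_update_inl, plaquetteHolonomy_update_of_not_mem (hblat k k' hkk')]
  have ht'_r : ∀ k k' W g, k ≠ k' → t' k' (update W (Sum.inr (bottom k)) g) = t' k' W := fun k k' W g hkk' => by
    simp only [ht', comp_inr_update_inr, plaquetteHolonomy_update_of_not_mem (hblat k k' hkk')]
  have hP_l : ∀ A k W g, k ∉ A → P A (update W (Sum.inl (bottom k)) g) = P A W := by
    intro A k W g hk
    simp only [hP]
    rw [Finset.prod_congr rfl fun k' hk' => ht_l k k' W g fun h => hk (h ▸ hk'),
      Finset.prod_congr rfl fun k' _ => ht'_l k' W (bottom k) g]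
  have hP_r : ∀ A k W g, k ∈ A → P A (update W (Sum.inr (bottom k)) g) = P A W := by
    intro A k W g hk
    simp only [hP]
    rw [Finset.prod_congr rfl fun k' _ => ht_r k' W (bottom k) g,
      Finset.prod_congr rfl fun k' hk' => ht'_r k k' W g fun h => by
        subst h; simp only [Finset.mem_sdiff] at hk'; exact hk'.2 hk]
  have hPu_r : ∀ W e g, P Finset.univ (update W (Sum.inr e) g) = P Finset.univ W := fun W e g => by
    simp only [hP, Finset.sdiff_self, Finset.prod_empty, ht_r]
  have hPe_l : ∀ W e g, P ∅ (update W (Sum.inl e) g) = P ∅ W := fun W e g => by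
    simp only [hP, Finset.prod_empty, Finset.sdiff_empty, ht'_l]
  have hb1 : (((0 : Site 4 L).shift 0, (1 : Fin 4)) : Edge 4 L) ∈
      ({(((0 : Site 4 L).shift 0), (1 : Fin 4)), (((0 : Site 4 L).shift 0).shift 1, (2 : Fin 4)),
        (((0 : Site 4 L).shift 0).shift 2, (1 : Fin 4)), (((0 : Site 4 L).shift 0), (2 : Fin 4))} : Finset (Edge 4 L)) := by
    simp
  have h12 : (1 : Fin 4) ≠ 2 := by decide
  have hne_univ : ∀ {A : Finset (Fin 4)}, A ≠ Finset.univ → ∃ k, k ∉ A := fun hA => by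
    by_contra h; push Not at h; exact hA (Finset.eq_univ_of_forall h)
  have hne_empty : ∀ {A : Finset (Fin 4)}, A ≠ ∅ → ∃ k, k ∈ A := fun hA =>
    Finset.nonempty_iff_ne_empty.2 hA
  ------------------------------------------------------------------ the two cube terms
  have hcube := cubeEdge_injective (L := L) hL
  have hshift20 : ((0 : Site 4 L).shift 2).shift 0 = ((0 : Site 4 L).shift 0).shift 2 := by
    simp only [Site.shift]; abel
  have hshift21 : ((0 : Site 4 L).shift 2).shift 1 = ((0 : Site 4 L).shift 1).shift 2 := by
    simp only [Site.shift]; abel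
  have hshift10 : ((0 : Site 4 L).shift 1).shift 0 = ((0 : Site 4 L).shift 0).shift 1 := by
    simp only [Site.shift]; abel
  have cubeL : ∫ W, X W * (Y W * P Finset.univ W) ∂μ₂ = ((haarConv φ)^[5] φ) 1 := by
    rw [← integral_cube_eq (ι := Edge 4 L ⊕ Edge 4 L) hφc hφz hφs (fun k => Sum.inl ((![((0 : Site 4 L), (1 : Fin 4)), ((0 : Site 4 L).shift 1, (2 : Fin 4)),
        ((0 : Site 4 L).shift 2, (1 : Fin 4)), ((0 : Site 4 L), (2 : Fin 4)),
        ((0 : Site 4 L).shift 0, (1 : Fin 4)), (((0 : Site 4 L).shift 0).shift 1, (2 : Fin 4)),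
        (((0 : Site 4 L).shift 0).shift 2, (1 : Fin 4)), ((0 : Site 4 L).shift 0, (2 : Fin 4)),
        ((0 : Site 4 L), (0 : Fin 4)), ((0 : Site 4 L).shift 1, (0 : Fin 4)),
        ((0 : Site 4 L).shift 2, (0 : Fin 4)), (((0 : Site 4 L).shift 1).shift 2, (0 : Fin 4))] :
          Fin 12 → Edge 4 L) k))
      (Sum.inl_injective.comp hcube)]
    refine integral_congr_ae (Eventually.of_forall fun W => ?_)
    simp only [hX, hY, hP, ht, hlat, Finset.sdiff_self, Finset.prod_empty, mul_one, Fin.prod_univ_four,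
      plaquetteHolonomy, Matrix.cons_val_zero, Matrix.cons_val_one, Matrix.cons_val, hshift20, hshift21, hshift10]
    ring
  have cubeR : ∫ W, X' W * (Y' W * P ∅ W) ∂μ₂ = ((haarConv φ)^[5] φ) 1 := by
    rw [← integral_cube_eq (ι := Edge 4 L ⊕ Edge 4 L) hφc hφz hφs (fun k => Sum.inr ((![((0 : Site 4 L), (1 : Fin 4)), ((0 : Site 4 L).shift 1, (2 : Fin 4)),
        ((0 : Site 4 L).shift 2, (1 : Fin 4)), ((0 : Site 4 L), (2 : Fin 4)),
        ((0 : Site 4 L).shift 0, (1 : Fin 4)), (((0 : Site 4 L).shift 0).shift 1, (2 : Fin 4)),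
        (((0 : Site 4 L).shift 0).shift 2, (1 : Fin 4)), ((0 : Site 4 L).shift 0, (2 : Fin 4)),
        ((0 : Site 4 L), (0 : Fin 4)), ((0 : Site 4 L).shift 1, (0 : Fin 4)),
        ((0 : Site 4 L).shift 2, (0 : Fin 4)), (((0 : Site 4 L).shift 1).shift 2, (0 : Fin 4))] :
          Fin 12 → Edge 4 L) k))
      (Sum.inr_injective.comp hcube)]
    refine integral_congr_ae (Eventually.of_forall fun W => ?_)
    simp only [hX', hY', hP, ht', hlat, Finset.sdiff_empty, Finset.prod_empty, one_mul, Fin.prod_univ_four,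
      plaquetteHolonomy, Matrix.cons_val_zero, Matrix.cons_val_one, Matrix.cons_val, hshift20, hshift21, hshift10]
    ring
  ------------------------------------------------------------------ the four families of terms
  have cXY : ∀ A, ∫ W, X W * (Y W * P A W) ∂μ₂ = if A = Finset.univ then ((haarConv φ)^[5] φ) 1 else 0 := by
    intro A
    by_cases hA : A = Finset.univ
    · subst hA; rw [if_pos rfl]; exact cubeL
    · rw [if_neg hA]
      obtain ⟨k₀, hk₀⟩ := hne_univ hA
      simp only [hX]
      rw [integral_peel_inl 0 h12 (hbP0 k₀) hφc (R := fun W => Y W * P A W) (hYm.mul (hPm A)) (h2b A hYb)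
        (fun W g => by rw [hY_l, hP_l A k₀ W g hk₀]), hφ0, zero_mul]
  have cXY' : ∀ A, ∫ W, X W * (Y' W * P A W) ∂μ₂ = 0 := by
    intro A
    by_cases hA : A = Finset.univ
    · subst hA
      have hre : ∀ W, X W * (Y' W * P Finset.univ W) = Y' W * (X W * P Finset.univ W) := fun W => by ring
      simp_rw [hre]
      simp only [hY']
      rw [integral_peel_inr ((0 : Site 4 L).shift 0) h12 hb1 hφc (R := fun W => X W * P Finset.univ W)
        (hXm.mul (hPm _)) (h2b _ hXb) (fun W g => by rw [hX_r, hPu_r]), hφ0, zero_mul]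
    · obtain ⟨k₀, hk₀⟩ := hne_univ hA
      simp only [hX]
      rw [integral_peel_inl 0 h12 (hbP0 k₀) hφc (R := fun W => Y' W * P A W) (hY'm.mul (hPm A)) (h2b A hY'b)
        (fun W g => by rw [hY'_l, hP_l A k₀ W g hk₀]), hφ0, zero_mul]
  have cX'Y : ∀ A, ∫ W, X' W * (Y W * P A W) ∂μ₂ = 0 := by
    intro A
    by_cases hA : A = ∅
    · subst hA
      have hre : ∀ W, X' W * (Y W * P ∅ W) = Y W * (X' W * P ∅ W) := fun W => by ring
      simp_rw [hre]
      simp only [hY]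
      rw [integral_peel_inl ((0 : Site 4 L).shift 0) h12 hb1 hφc (R := fun W => X' W * P ∅ W)
        (hX'm.mul (hPm _)) (h2b _ hX'b) (fun W g => by rw [hX'_l, hPe_l]), hφ0, zero_mul]
    · obtain ⟨k₀, hk₀⟩ := hne_empty hA
      simp only [hX']
      rw [integral_peel_inr 0 h12 (hbP0 k₀) hφc (R := fun W => Y W * P A W) (hYm.mul (hPm A)) (h2b A hYb)
        (fun W g => by rw [hY_r, hP_r A k₀ W g hk₀]), hφ0, zero_mul]
  have cX'Y' : ∀ A, ∫ W, X' W * (Y' W * P A W) ∂μ₂ = if A = ∅ then ((haarConv φ)^[5] φ) 1 else 0 := by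
    intro A
    by_cases hA : A = ∅
    · subst hA; rw [if_pos rfl]; exact cubeR
    · rw [if_neg hA]
      obtain ⟨k₀, hk₀⟩ := hne_empty hA
      simp only [hX']
      rw [integral_peel_inr 0 h12 (hbP0 k₀) hφc (R := fun W => Y' W * P A W) (hY'm.mul (hPm A)) (h2b A hY'b)
        (fun W g => by rw [hY'_r, hP_r A k₀ W g hk₀]), hφ0, zero_mul]
  ------------------------------------------------------------------ expansion and summation
  have hexp : ∀ W, (X W - X' W) * (Y W - Y' W) * ∏ k, (t k W + t' k W) =
      ∑ A ∈ (Finset.univ : Finset (Fin 4)).powerset,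
        (X W * (Y W * P A W) - X W * (Y' W * P A W) - X' W * (Y W * P A W) + X' W * (Y' W * P A W)) := by
    intro W
    rw [Finset.prod_add, Finset.mul_sum]
    exact Finset.sum_congr rfl fun A _ => by simp only [hP]; ring
  change ∫ W, (X W - X' W) * (Y W - Y' W) * ∏ k, (t k W + t' k W) ∂μ₂ = _
  simp_rw [hexp]
  have hint : ∀ A, Integrable (fun W => X W * (Y W * P A W) - X W * (Y' W * P A W) - X' W * (Y W * P A W) +
      X' W * (Y' W * P A W)) μ₂ := fun A =>
    (((hI (h3m A hXm hYm) (h3b A hXb hYb)).sub (hI (h3m A hXm hY'm) (h3b A hXb hY'b))).sub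
      (hI (h3m A hX'm hYm) (h3b A hX'b hYb))).add (hI (h3m A hX'm hY'm) (h3b A hX'b hY'b))
  rw [integral_finsetSum _ fun A _ => hint A]
  have hsum : ∀ A, ∫ W, (X W * (Y W * P A W) - X W * (Y' W * P A W) - X' W * (Y W * P A W) +
      X' W * (Y' W * P A W)) ∂μ₂ =
      (if A = Finset.univ then ((haarConv φ)^[5] φ) 1 else 0) + (if A = ∅ then ((haarConv φ)^[5] φ) 1 else 0) := by
    intro A
    rw [integral_add _ (hI (h3m A hX'm hY'm) (h3b A hX'b hY'b)), integral_sub _ (hI (h3m A hX'm hYm) (h3b A hX'b hYb)),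
      integral_sub (hI (h3m A hXm hYm) (h3b A hXb hYb)) (hI (h3m A hXm hY'm) (h3b A hXb hY'b)), cXY, cXY', cX'Y, cX'Y']
    · ring
    · exact (hI (h3m A hXm hYm) (h3b A hXb hYb)).sub (hI (h3m A hXm hY'm) (h3b A hXb hY'b))
    · exact ((hI (h3m A hXm hYm) (h3b A hXb hYb)).sub (hI (h3m A hXm hY'm) (h3b A hXb hY'b))).sub
        (hI (h3m A hX'm hYm) (h3b A hX'b hYb))
  simp only [hsum, Finset.sum_add_distrib, Finset.sum_ite_eq', Finset.mem_powerset, Finset.subset_univ, if_true]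
  ring

end Summit.QuantumFields.YangMills.Cruxes.IR.SCFloor

end
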